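import Mathlib.MeasureTheory.Constructions.BorelSpace.Complex
import Literature.Analysis.OperatorTheory.KernelPathIntegralPeeling
import HarnessLib

/-!
# Peeling the cyclic path integral of a complex (`RCLike`) transfer kernel with one site insertion

Topic `Literature/Analysis/OperatorTheory`; the `RCLike 𝕜`-valued (in particular complex) port of the REAL files
`KernelPathIntegralPeeling.lean` (`integral_pathWeight_succ_eq`) and `KernelCyclicPeeling.lean`
(`integral_pi_succ_eq_integral_cons`, `prod_cyclic_cons`, `integral_pathWeight_mul_kernel_last_eq_iterate`,
`integral_cyclic_eq_integral_iterate`), restricted to what the graded trace formula of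
`HermitianKernelSpectralTrace.lean` consumes.  For a bounded measurable kernel `K : Y → Y → 𝕜` on a FINITE
measure space `(Y, ρ)` write `(κ f)(w) = ∫ K(w, z) f(z) dρ(z)` for the pointwise transfer operator (written out,
no definition) and `u ∷ ζ = Fin.cons u ζ`.  Everything is PROVED (Fubini along `Fin.cons` on the finite product
measure; all integrands are bounded and measurable):

* `measurable_pathWeight_rclike`, `norm_pathWeight_le_rclike` — bookkeeping for the open path weight
  `W(u, ζ) = ∏_{i : Fin M} K((u ∷ ζ)ᵢ, ζᵢ)` (`|W| ≤ C^M`);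
* `integral_pathWeight_succ_eq_rclike` — ONE-STEP PEELING (Markov property)
  `∫ W(u,ζ) F(ζ) dρ^{⊗(M+1)}(ζ) = ∫ K(u,y) [∫ W(y,ζ') F(y ∷ ζ') dρ^{⊗M}(ζ')] dρ(y)`;
* `integral_pi_succ_eq_integral_cons_rclike` — `∫ Φ dρ^{⊗(M+1)} = ∫ (∫ Φ(y ∷ ζ') dρ^{⊗M}(ζ')) dρ(y)`;
* `prod_cyclic_cons_last` — cutting the cycle of `k + 2` sites at site `0` (pure algebra, any `CommMonoid`);
* `integral_pathWeight_mul_kernel_last_eq_iterate_rclike` — the closing arc is the iterated kernel: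
  `∫ W(y,η) K((y∷η)_last, x) dρ^{⊗k}(η) = (κ^[k] K(·, x))(y)`;
* `integral_cyclic_obs_eq_integral_iterate_rclike` (**main**) — the periodic path integral with ONE bounded
  one-site insertion `F` at site `0` is the diagonal integral of the iterated kernel:
  `∫ F(V 0) ∏_{t : Fin (M+2)} K(V t, V (t+1)) dρ^{⊗(M+2)}(V) = ∫ F(x) (κ^[M+1] K(·, x))(x) dρ(x)`
  ("`Tr(F 𝕋^{M+2})`" in path-space form; the spectral side is `HermitianKernelSpectralTrace.lean`).

This is the configuration-space half of the transfer-matrix trace formula for time-sliced models with periodic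
(time) boundary conditions and complex Boltzmann weights (e.g. lattice gauge theory with fermion parity
insertions).  References: B. Simon, *Trace Ideals and Their Applications* (2005), Ch. 3; M. Reed, B. Simon,
*Methods of Modern Mathematical Physics I* (1980), §VI.6.  Mathlib + `KernelPathIntegralPeeling.lean`
(`measurable_finCons`) only; no definitions. [folklore]
-/

noncomputable section

open MeasureTheory Filter Set Function

namespace Literature.Analysis.OperatorTheory

section CommMonoid

variable {Y : Type*} {M₀ : Type*} [CommMonoid M₀]

/-- **Cutting the cycle at site `0`.** For `V = x ∷ ζ` on the cycle of `k + 2` sites, the periodic weight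
`∏_{t : Fin (k+2)} K(V t, V (t + 1))` (`Fin` addition: the last bond is `K(V (k+1), V 0)`) is the open path weight
`∏_{i : Fin (k+1)} K((x ∷ ζ)ᵢ, ζᵢ)` times the closing bond `K((x ∷ ζ)_{k+1}, x)` (any commutative monoid of
weights). [folklore] -/
theorem prod_cyclic_cons_last (K : Y → Y → M₀) (k : ℕ) (x : Y) (ζ : Fin (k + 1) → Y) :
    ∏ t : Fin (k + 2), K ((Fin.cons x ζ : Fin (k + 2) → Y) t) ((Fin.cons x ζ : Fin (k + 2) → Y) (t + 1)) =
      (∏ i : Fin (k + 1), K ((Fin.cons x ζ : Fin (k + 2) → Y) (Fin.castSucc i)) (ζ i)) *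
        K ((Fin.cons x ζ : Fin (k + 2) → Y) (Fin.last (k + 1))) x := by
  rw [Fin.prod_univ_castSucc]
  congr 1
  · refine Finset.prod_congr rfl fun i _ => ?_
    rw [Fin.coeSucc_eq_succ, Fin.cons_succ]
  · rw [Fin.last_add_one, Fin.cons_zero]

end CommMonoid

variable {𝕜 : Type*} [RCLike 𝕜] {Y : Type*} [MeasurableSpace Y] {ρ : Measure Y} [IsFiniteMeasure ρ]
  {K : Y → Y → 𝕜} {C : ℝ}

omit [IsFiniteMeasure ρ] in
/-- Measurability of the path weight `ζ ↦ ∏ᵢ K((u ∷ ζ)ᵢ, ζᵢ)` of a block of `M` sites with left boundary spin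
`u`, jointly in `(u, ζ)` (`RCLike`-valued kernel). [folklore] -/
theorem measurable_pathWeight_rclike {K : Y → Y → 𝕜} (hK : Measurable (uncurry K)) (M : ℕ) :
    Measurable fun p : Y × (Fin M → Y) =>
      ∏ i : Fin M, K ((Fin.cons p.1 p.2 : Fin (M + 1) → Y) (Fin.castSucc i)) (p.2 i) := by
  refine Finset.measurable_prod _ fun i _ => ?_
  have h1 : Measurable fun p : Y × (Fin M → Y) =>
      (Fin.cons p.1 p.2 : Fin (M + 1) → Y) (Fin.castSucc i) :=
    (measurable_pi_apply _).comp (measurable_finCons M)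
  have h2 : Measurable fun p : Y × (Fin M → Y) => p.2 i := (measurable_pi_apply i).comp measurable_snd
  exact hK.comp (h1.prodMk h2)

omit [MeasurableSpace Y] in
/-- The path weight is bounded by `C^M` when `‖K‖ ≤ C` (`RCLike`-valued kernel). [folklore] -/
theorem norm_pathWeight_le_rclike {K : Y → Y → 𝕜} (hC : ∀ x y, ‖K x y‖ ≤ C) (M : ℕ) (u : Y)
    (ζ : Fin M → Y) :
    ‖∏ i : Fin M, K ((Fin.cons u ζ : Fin (M + 1) → Y) (Fin.castSucc i)) (ζ i)‖ ≤ C ^ M := by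
  calc ‖∏ i : Fin M, K ((Fin.cons u ζ : Fin (M + 1) → Y) (Fin.castSucc i)) (ζ i)‖
      ≤ ∏ i : Fin M, ‖K ((Fin.cons u ζ : Fin (M + 1) → Y) (Fin.castSucc i)) (ζ i)‖ :=
        Finset.norm_prod_le _ _
    _ ≤ ∏ _i : Fin M, C := Finset.prod_le_prod (fun i _ => norm_nonneg _) fun i _ => hC _ _
    _ = C ^ M := by simp

/-- **One-step peeling (Markov property of the path weight), `RCLike`-valued kernel.** For a bounded
measurable kernel `K` on a finite measure space, a block of `M + 1` sites with left boundary spin `u` and a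
bounded measurable `𝕜`-valued function `F` of the block,
`∫ (∏ᵢ K((u∷ζ)ᵢ, ζᵢ)) F(ζ) dρ^{⊗(M+1)}(ζ) = ∫ K(u,y) [∫ (∏ᵢ K((y∷ζ')ᵢ, ζ'ᵢ)) F(y∷ζ') dρ^{⊗M}(ζ')] dρ(y)`
(Fubini along `Fin.cons`, Mathlib `measurePreserving_piFinSuccAbove`; port of `integral_pathWeight_succ_eq`).
[folklore] -/
theorem integral_pathWeight_succ_eq_rclike (hK : Measurable (uncurry K)) (hC : ∀ x y, ‖K x y‖ ≤ C)
    (M : ℕ) (u : Y) {F : (Fin (M + 1) → Y) → 𝕜} (hF : Measurable F) {B : ℝ} (hFb : ∀ ζ, ‖F ζ‖ ≤ B) :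
    ∫ ζ : Fin (M + 1) → Y, (∏ i : Fin (M + 1),
        K ((Fin.cons u ζ : Fin (M + 2) → Y) (Fin.castSucc i)) (ζ i)) * F ζ ∂(Measure.pi fun _ => ρ) =
      ∫ y, K u y * ∫ ζ' : Fin M → Y, (∏ i : Fin M,
        K ((Fin.cons y ζ' : Fin (M + 1) → Y) (Fin.castSucc i)) (ζ' i)) *
          F (Fin.cons y ζ') ∂(Measure.pi fun _ => ρ) ∂ρ := by
  set pi : Measure (Fin M → Y) := Measure.pi fun _ => ρ with hpi
  have hmp := (measurePreserving_piFinSuccAbove (fun _ : Fin (M + 1) => ρ) 0).symm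
  -- the integrand transported to `Y × (Fin M → Y)`
  set G : (Fin (M + 1) → Y) → 𝕜 := fun ζ =>
    (∏ i : Fin (M + 1), K ((Fin.cons u ζ : Fin (M + 2) → Y) (Fin.castSucc i)) (ζ i)) * F ζ with hG
  have hcons : ∀ (y : Y) (ζ' : Fin M → Y),
      G (Fin.cons y ζ') = K u y * ((∏ i : Fin M,
        K ((Fin.cons y ζ' : Fin (M + 1) → Y) (Fin.castSucc i)) (ζ' i)) * F (Fin.cons y ζ')) := by
    intro y ζ'
    rw [hG]
    dsimp only
    rw [Fin.prod_univ_succ]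
    simp only [Fin.cons_zero, Fin.cons_succ, Fin.castSucc_zero, ← Fin.succ_castSucc]
    ring
  have he : ∀ p : Y × (Fin M → Y),
      (MeasurableEquiv.piFinSuccAbove (fun _ : Fin (M + 1) => Y) 0).symm p = Fin.cons p.1 p.2 := by
    intro p
    simp only [MeasurableEquiv.piFinSuccAbove_symm_apply, Fin.insertNthEquiv, Fin.insertNth_zero,
      Equiv.coe_fn_mk]
    rfl
  -- change of variables
  have h1 : ∫ ζ, G ζ ∂(Measure.pi fun _ : Fin (M + 1) => ρ) =
      ∫ p, G (Fin.cons p.1 p.2) ∂(ρ.prod pi) := by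
    rw [← hmp.integral_comp']
    refine integral_congr_ae (Eventually.of_forall fun p => ?_)
    dsimp only
    rw [he]
  rw [h1]
  -- Fubini
  have hcm : Measurable fun p : Y × (Fin M → Y) => (Fin.cons p.1 p.2 : Fin (M + 1) → Y) :=
    measurable_finCons M
  have hGm : Measurable G := by
    have hw := measurable_pathWeight_rclike hK (M + 1)
    exact (hw.comp (measurable_const.prodMk measurable_id)).mul hF
  have hC0 : 0 ≤ C := (norm_nonneg _).trans (hC u u)
  have hB0 : 0 ≤ B := (norm_nonneg _).trans (hFb (Fin.cons u fun _ => u))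
  have hGb : ∀ ζ, ‖G ζ‖ ≤ C ^ (M + 1) * B := fun ζ => by
    rw [hG]; dsimp only; rw [norm_mul]
    exact mul_le_mul (norm_pathWeight_le_rclike hC (M + 1) u ζ) (hFb ζ) (norm_nonneg _) (by positivity)
  have hint : Integrable (fun p : Y × (Fin M → Y) => G (Fin.cons p.1 p.2)) (ρ.prod pi) := by
    have hmeas : AEStronglyMeasurable (fun p : Y × (Fin M → Y) => G (Fin.cons p.1 p.2)) (ρ.prod pi) :=
      (hGm.comp hcm).aestronglyMeasurable
    exact memLp_one_iff_integrable.1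
      (MemLp.of_bound hmeas (C ^ (M + 1) * B) (Eventually.of_forall fun p => hGb _))
  rw [integral_prod _ hint]
  refine integral_congr_ae (Eventually.of_forall fun y => ?_)
  dsimp only
  simp_rw [hcons]
  rw [integral_const_mul]

/-- **Fubini along `Fin.cons`** (`RCLike`-valued integrand): for a bounded measurable `Φ` on a block of
`M + 1` sites, `∫ Φ dρ^{⊗(M+1)} = ∫ (∫ Φ(y ∷ ζ') dρ^{⊗M}(ζ')) dρ(y)` (Mathlib `measurePreserving_piFinSuccAbove` at
the pivot `0`; port of `integral_pi_succ_eq_integral_cons`). [folklore] -/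
theorem integral_pi_succ_eq_integral_cons_rclike (M : ℕ) {Φ : (Fin (M + 1) → Y) → 𝕜} (hΦ : Measurable Φ)
    {B : ℝ} (hΦb : ∀ ζ, ‖Φ ζ‖ ≤ B) :
    ∫ ζ, Φ ζ ∂(Measure.pi fun _ : Fin (M + 1) => ρ) =
      ∫ y, ∫ ζ' : Fin M → Y, Φ (Fin.cons y ζ') ∂(Measure.pi fun _ => ρ) ∂ρ := by
  set pi : Measure (Fin M → Y) := Measure.pi fun _ => ρ with hpi
  have hmp := (measurePreserving_piFinSuccAbove (fun _ : Fin (M + 1) => ρ) 0).symm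
  have he : ∀ p : Y × (Fin M → Y),
      (MeasurableEquiv.piFinSuccAbove (fun _ : Fin (M + 1) => Y) 0).symm p = Fin.cons p.1 p.2 := by
    intro p
    simp only [MeasurableEquiv.piFinSuccAbove_symm_apply, Fin.insertNthEquiv, Fin.insertNth_zero,
      Equiv.coe_fn_mk]
    rfl
  have h1 : ∫ ζ, Φ ζ ∂(Measure.pi fun _ : Fin (M + 1) => ρ) =
      ∫ p, Φ (Fin.cons p.1 p.2) ∂(ρ.prod pi) := by
    rw [← hmp.integral_comp']
    refine integral_congr_ae (Eventually.of_forall fun p => ?_)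
    dsimp only
    rw [he]
  rw [h1]
  have hcm : Measurable fun p : Y × (Fin M → Y) => (Fin.cons p.1 p.2 : Fin (M + 1) → Y) :=
    measurable_finCons M
  have hint : Integrable (fun p : Y × (Fin M → Y) => Φ (Fin.cons p.1 p.2)) (ρ.prod pi) :=
    memLp_one_iff_integrable.1
      (MemLp.of_bound (hΦ.comp hcm).aestronglyMeasurable B (Eventually.of_forall fun p => hΦb _))
  rw [integral_prod _ hint]

/-- **The closing arc is an iterated kernel** (`RCLike`-valued kernel): for every `x, y`,
`∫ (∏ᵢ K((y ∷ η)ᵢ, ηᵢ)) K((y ∷ η)_{last}, x) dρ^{⊗k}(η) = (κ^[k] K(·, x))(y)` — the `k + 1` bonds from `y` through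
the `k` integrated sites to `x` give the iterated kernel `K^{(k+1)}(y, x)` (port of
`integral_pathWeight_mul_kernel_last_eq_iterate`). [folklore] -/
theorem integral_pathWeight_mul_kernel_last_eq_iterate_rclike (hK : Measurable (uncurry K))
    (hC : ∀ x y, ‖K x y‖ ≤ C) (x : Y) (k : ℕ) (y : Y) :
    ∫ η : Fin k → Y, (∏ i : Fin k, K ((Fin.cons y η : Fin (k + 1) → Y) (Fin.castSucc i)) (η i)) *
        K ((Fin.cons y η : Fin (k + 1) → Y) (Fin.last k)) x ∂(Measure.pi fun _ => ρ) =
      (fun f : Y → 𝕜 => fun w => ∫ z, K w z * f z ∂ρ)^[k] (fun z => K z x) y := by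
  induction k generalizing y with
  | zero =>
    simp only [Finset.univ_eq_empty, Finset.prod_empty, one_mul, Fin.last_zero, Fin.cons_zero,
      Function.iterate_zero, id_eq]
    rw [integral_const]
    have : (Measure.pi fun _ : Fin 0 => ρ).real univ = 1 := by
      rw [measureReal_def, Measure.pi_univ]
      simp
    rw [this, one_smul]
  | succ k ih =>
    have hKx : Measurable fun z => K z x := hK.comp (measurable_id.prodMk measurable_const)
    have hFm : Measurable fun η : Fin (k + 1) → Y => K (η (Fin.last k)) x :=
      hKx.comp (measurable_pi_apply _)
    have h1 := integral_pathWeight_succ_eq_rclike (ρ := ρ) hK hC k y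
      (F := fun η : Fin (k + 1) → Y => K (η (Fin.last k)) x) hFm (fun η => hC _ _)
    have hlast : ∀ η : Fin (k + 1) → Y,
        (Fin.cons y η : Fin (k + 1 + 1) → Y) (Fin.last (k + 1)) = η (Fin.last k) := fun η => by
      rw [← Fin.succ_last, Fin.cons_succ]
    simp_rw [hlast]
    rw [h1, Function.iterate_succ_apply']
    refine integral_congr_ae (Eventually.of_forall fun w => ?_)
    dsimp only
    rw [← ih w]

/-- **Trace formula for the cycle with one site insertion (periodic boundary conditions), `RCLike`-valued
kernel.** Let `K` be a bounded measurable `𝕜`-valued kernel on a finite measure space `(Y, ρ)`,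
`κ f = ∫ K(·, z) f(z) dρ(z)`, and `F` a bounded measurable one-site observable. On the cycle of `M + 2` sites with
the periodic weight `∏_{t : Fin (M+2)} K(V t, V (t+1))` and `F` inserted at site `0`,
`∫ F(V 0) ∏_t K(V t, V (t+1)) dρ^{⊗(M+2)}(V) = ∫ F(x) (κ^[M+1] K(·, x))(x) dρ(x)`:
the `M + 2` bonds from `x` around the cycle back to `x` become the diagonal of the iterated kernel `K^{(M+2)}(x, x)`
(the path-space form of `Tr(F 𝕋^{M+2})`; port of `integral_cyclic_eq_integral_iterate` with a single insertion).
[folklore] -/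
theorem integral_cyclic_obs_eq_integral_iterate_rclike (hK : Measurable (uncurry K))
    (hC : ∀ x y, ‖K x y‖ ≤ C) (M : ℕ) {F : Y → 𝕜} (hF : Measurable F) {BF : ℝ} (hFb : ∀ y, ‖F y‖ ≤ BF) :
    ∫ V : Fin (M + 2) → Y, F (V 0) * ∏ t, K (V t) (V (t + 1)) ∂(Measure.pi fun _ => ρ) =
      ∫ x, F x * (fun f : Y → 𝕜 => fun w => ∫ z, K w z * f z ∂ρ)^[M + 1] (fun z => K z x) x ∂ρ := by
  -- Step 1: cut the cycle at site `0` (Fubini along `Fin.cons`)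
  have hΦm : Measurable fun V : Fin (M + 2) → Y => F (V 0) * ∏ t, K (V t) (V (t + 1)) := by
    refine (hF.comp (measurable_pi_apply 0)).mul ?_
    refine Finset.measurable_prod _ fun t _ => ?_
    exact hK.comp ((measurable_pi_apply (X := fun _ : Fin (M + 2) => Y) t).prodMk
      (measurable_pi_apply (X := fun _ : Fin (M + 2) => Y) (t + 1)))
  have hΦb : ∀ V : Fin (M + 2) → Y, ‖F (V 0) * ∏ t, K (V t) (V (t + 1))‖ ≤ BF * C ^ (M + 2) := by
    intro V
    have hBF : 0 ≤ BF := (norm_nonneg _).trans (hFb (V 0))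
    have hP : ‖∏ t, K (V t) (V (t + 1))‖ ≤ C ^ (M + 2) := by
      calc ‖∏ t, K (V t) (V (t + 1))‖ ≤ ∏ t, ‖K (V t) (V (t + 1))‖ := Finset.norm_prod_le _ _
        _ ≤ ∏ _t : Fin (M + 2), C := Finset.prod_le_prod (fun t _ => norm_nonneg _) fun t _ => hC _ _
        _ = C ^ (M + 2) := by simp
    rw [norm_mul]
    exact mul_le_mul (hFb _) hP (norm_nonneg _) hBF
  rw [integral_pi_succ_eq_integral_cons_rclike (ρ := ρ) (M + 1) hΦm hΦb]
  refine integral_congr_ae (Eventually.of_forall fun x => ?_)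
  dsimp only
  -- Step 2: the periodic weight on `x ∷ ζ` = open path weight × closing bond; Step 3: the closing arc
  simp_rw [prod_cyclic_cons_last K M x, Fin.cons_zero]
  rw [integral_const_mul, integral_pathWeight_mul_kernel_last_eq_iterate_rclike (ρ := ρ) hK hC x (M + 1) x]

end Literature.Analysis.OperatorTheory

end
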